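import Summits.BirchSwinnertonDyer.BirchSwinnertonDyer.Theorems.PrintCf2RubinValueTwoKatzJZeroUniqueSupply
import Summits.Langlands.Langlands.Theorems.IrreducibilityBySelfDualityReciprocityUpToIrreducibilityHeckeTypeZeroFiniteOrder
import Literature.NumberTheory.GaloisRepresentations.CMTypeHeckeCharacter
import Literature.NumberTheory.GaloisRepresentations.ArtinReciprocityCharacterProofs
import Literature.NumberTheory.GaloisRepresentations.HeckeLFunctionValueOfNegativeWeight
import Literature.NumberTheory.EllipticCurves.DeShalit1987.EisensteinClassSumInterpolation
import Literature.NumberTheory.EllipticCurves.DeShalit1987.KatzPAdicLFunction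
import HarnessLib

set_option linter.dupNamespace false
set_option autoImplicit false

/-!
# RANGE DECOMPOSITION and THE COMPLEX VALUE for the `j = 0` endpoint: an arbitrary range character `ε` of type `(−m, 0)`
# unramified off `T` IS `χ⁻¹·λ^{−m}` off `∏_{w ∈ T} w^{M+1}` (`χ` a ray class character, every deep `M`), and then
# `interpolationValue … ε m 0 … = (1 − ε(𝔭)⁻¹p⁻¹) × Σ_𝔠 χ̃(𝔠)⁻¹λ̃(𝔠)^{−m} E_m(Ω, L𝔠)` (de Shalit II.4.14 (36) ⇐ (40))

Cell `bsd-print-cf2`, width seat `bsd-line-cf2-p1-w7` g14; print leaf 24720 `KatzDistributionsAtTwoPrint` under director OPTION 1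
(`j = 0` twin), R3 endpoint `Cruxes/KatzDistributionsAtTwoPrint/Lines/katz_measure_two_R3_endpoint.lean`; piece A7 of the
(e)-assembly (complex side).  `--supports stmt-BirchSwinnertonDyer-24720` (helper, Theses-free).  THEOREMS ONLY (no `def`, no named
fact, no `sorry`); nothing is closed; BSD is not proved by any of this; no summit statement is proved by this seat.

WHY.  The complex side of de Shalit II.4.14 (36) at `j = 0` is in the tree as ONE statement
(`DeShalit1987.sum_eisensteinE_eq_removedEulerFactorsAtZero_mul_continuation`, -w7 g13), parametrised by a type-`(1,0)` character
`λ` with a module of definition `(Tl, el)`, a RAY CLASS CHARACTER `χ` modulo `𝔪 = ∏_{w∈Tl} w^{el w + 1}`, an exponent `k`, and an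
`L`-function character `η` with `η(ϖ_v) = χ(v)⁻¹·λ(ϖ_v)^{−k}` off `𝔪` and ramification inside `Tl`.  The endpoint quantifies over an
ARBITRARY `ε` of type `(−m, 0)` unramified outside `T = S ∪ {v̄}`.  This file supplies, from `ε` and the frame's `λ`, the data
`(χ, M)` BY NAME: for every `M ≥ M₀`, `(T, M)` is a module of definition of `λ`, of `ε` and of the type-`(0,0)` character
`(ε·λ^m)⁻¹`, whose values at uniformisers form a ray class character `χ` modulo `𝔪_M = ∏_{w∈T} w^{M+1}` (the lane's moduli
`𝔤^{M+1} v̄^{M+1}`), with `ε(ϖ_v) = χ(v)⁻¹·λ(ϖ_v)^{−m}` off `𝔪_M` — exactly the inputs `hlmod`, `hχ`, `hval`, `hram` of the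
one-stop theorem, uniformly in the level `M` at which the `p`-adic side is read.

* §1 moduli: `isModulus_mono` (raising exponents), `isModulus_inv`, `isModulus_const_of_le` (a module of definition `(T, e)` gives
  `(T, M)` for `M ≥ max e`), `exists_isModulus_const` (every character unramified off `T` has `(T, M)` for `M ≫ 0`).
* §2 values and types: `hasInfinityType_zero_mul_pow` (`(ε·λ^m)⁻¹` has type `(0,0)`), `valueAtUniformizer_eq_inv_mul_inv_pow`
  (the `hval` clause, at every place).
* §3 ★★ `exists_rayClassCharacter_range_decomposition` — the statement above.
* §4 `norm_apply_eq_ideleNorm_rpow_of_type_neg` (exponent `m/2`: the `hη` input), `one_lt_half_iff` (`1 < m/2 ↔ 3 ≤ m`: `h1`).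
* §5 ★★ `interpolationValue_zero_eq` (unfolding at `j = 0`), ★★ `interpolationValue_zero_eq_eulerFactor_mul_sum_eisensteinE`
  (THE COMPLEX VALUE OF THE ENDPOINT = `(1 − ε(ϖ_v)⁻¹p⁻¹) ×` the class sum of Eisenstein numbers, by the one-stop theorem with
  `η := ε`, `Tl := S ∪ {v̄}`, `el := M`, `k := m`), ★★ `twist_mul_interpolationValue_zero_eq_eulerFactor_mul_sum` (the 𝔞-twisted form
  the elliptic-unit measure delivers: `(N𝔞 − χ̃(𝔞)λ̃(𝔞)^m) × value = (1 − ε(ϖ_v)⁻¹p⁻¹) × Σ_𝔠 …(N𝔞·E_m(Ω,L𝔠) − E_m(Ω,L(𝔞𝔠)))`).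
  What is left to the (e)-assembler on the complex side: nothing — match the `p`-adic cell sum with this class sum (A4: the Euler factor
  `(1 − ε(ϖ_v)⁻¹p⁻¹)` against the socket's `(1 − u π′^k φ)`; A5: `Ω^{−m}`/`Ω_p^m` bookkeeping).

References: [deShalit1987] II.4.11 (29), II.4.12 (32), II.4.14 (36) (p. 65–71); [NeukirchANT1999] Ch. VII §6 (6.9), (6.11)–(6.14).
-/

noncomputable section

open scoped NumberField Classical
open NumberField IsDedekindDomain Field
open Literature Literature.NumberTheory.GaloisRepresentations Literature.NumberTheory.EllipticCurves
open Literature.NumberTheory.LFunctions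

namespace Summit.BirchSwinnertonDyer.BirchSwinnertonDyer.Theorems.PrintCf2.KatzJZeroRange

variable {K : Type} [Field K] [NumberField K]

/-! ## §1 Moduli of definition: raising exponents, inverses, a common constant exponent -/

/-- **Raising the exponents of a module of definition keeps it one** (the congruence conditions only get stronger).
[cite: NeukirchANT1999, Ch. VII §6 (6.11)] -/
theorem isModulus_mono {χ : HeckeCharacter K} {T : Finset (HeightOneSpectrum (𝓞 K))}
    {e e' : HeightOneSpectrum (𝓞 K) → ℕ} (hmod : χ.IsModulus T e) (hle : ∀ v ∈ T, e v ≤ e' v) :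
    χ.IsModulus T e' := by
  intro x h1 h2 h3
  refine hmod x h1 h2 fun v hv ↦ (h3 v hv).trans ?_
  rw [WithZero.exp_le_exp]
  have := hle v hv
  omega

/-- A module of definition of `χ` is one of `χ⁻¹`. [cite: NeukirchANT1999, Ch. VII §6 (6.11)] -/
theorem isModulus_inv {χ : HeckeCharacter K} {T : Finset (HeightOneSpectrum (𝓞 K))}
    {e : HeightOneSpectrum (𝓞 K) → ℕ} (hmod : χ.IsModulus T e) : χ⁻¹.IsModulus T e := fun x h1 h2 h3 ↦ by
  rw [HeckeCharacter.inv_apply, hmod x h1 h2 h3, inv_one]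

/-- From a module of definition `(T, e)` to the constant-exponent one `(T, M)` for `M ≥ e` on `T`.
[cite: NeukirchANT1999, Ch. VII §6 (6.11)] -/
theorem isModulus_const_of_le {χ : HeckeCharacter K} {T : Finset (HeightOneSpectrum (𝓞 K))}
    {e : HeightOneSpectrum (𝓞 K) → ℕ} (hmod : χ.IsModulus T e) {M : ℕ} (hM : ∀ v ∈ T, e v ≤ M) :
    χ.IsModulus T (fun _ ↦ M) :=
  isModulus_mono hmod hM

/-- **Every Hecke character unramified off the finite set `T` has `(T, M)` as a module of definition for all `M ≫ 0`**: move the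
support of a module of definition on the ramified places (`exists_isModulus_of_ramified`) to `T` (`IsModulus.of_isUnramifiedAt`) and
raise the exponents to their maximum over `T`. [cite: NeukirchANT1999, Ch. VII §6 (6.11)–(6.12)] -/
theorem exists_isModulus_const (χ : HeckeCharacter K) {T : Finset (HeightOneSpectrum (𝓞 K))}
    (hT : ∀ v : HeightOneSpectrum (𝓞 K), v ∉ T → χ.IsUnramifiedAt v) :
    ∃ M₀ : ℕ, ∀ M : ℕ, M₀ ≤ M → χ.IsModulus T (fun _ ↦ M) := by
  obtain ⟨e, hmod⟩ := χ.exists_isModulus_of_ramified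
  have hmodT : χ.IsModulus T e := hmod.of_isUnramifiedAt fun v hv hvT ↦ by
    exfalso
    exact ((HeckeCharacter.finite_ramifiedPlaces_holds χ).mem_toFinset.mp hv) (hT v hvT)
  refine ⟨T.sup e, fun M hM ↦ isModulus_const_of_le hmodT fun v hv ↦ (Finset.le_sup hv).trans hM⟩

/-! ## §2 Values and types -/

/-- **`ε·λ^m` has infinity type `(0,0)`** for `ε` of type `(−m, 0)` and `λ` of type `(1, 0)` — so its inverse is a ray class
character on any module of definition (Neukirch VII (6.9)). [cite: NeukirchANT1999, Ch. VII §6 Prop. (6.9)] [cite: deShalit1987, II.4.12 (p. 66)] -/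
theorem hasInfinityType_zero_mul_pow {lam ε : HeckeCharacter K} {m : ℕ}
    (hl : lam.HasInfinityType (fun _ ↦ 1) (fun _ ↦ 0))
    (hε : ε.HasInfinityType (fun _ ↦ -(m : ℤ)) (fun _ ↦ 0)) :
    (ε * lam ^ m)⁻¹.HasInfinityType 0 0 := by
  have hpow : (lam ^ m).HasInfinityType ((m : ℤ) • fun _ ↦ (1 : ℤ)) ((m : ℤ) • fun _ ↦ (0 : ℤ)) := by
    have h := hl.zpow' (m : ℤ)
    rwa [zpow_natCast] at h
  have h := (hε.mul' hpow).inv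
  have e1 : (-((fun _ ↦ -(m : ℤ)) + (m : ℤ) • fun _ ↦ (1 : ℤ)) : InfinitePlace K → ℤ) = 0 := by
    funext w; simp
  have e2 : (-((fun _ ↦ (0 : ℤ)) + (m : ℤ) • fun _ ↦ (0 : ℤ)) : InfinitePlace K → ℤ) = 0 := by
    funext w; simp
  rwa [e1, e2] at h

/-- Values at uniformisers are non-zero (they are values of units). [folklore] -/
private theorem valueAtUniformizer_ne_zero₇ (χ : HeckeCharacter K) (v : HeightOneSpectrum (𝓞 K)) :
    χ.valueAtUniformizer v ≠ 0 := by
  rw [HeckeCharacter.valueAtUniformizer]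
  exact Units.ne_zero _

/-- **The value identity** `ε(ϖ_v) = χ(v)⁻¹·λ(ϖ_v)^{−m}` with `χ = ((ε·λ^m)⁻¹)(ϖ_·)`, at EVERY finite place (values at uniformisers
are multiplicative). [cite: deShalit1987, II.4.11 (29) (p. 65)] -/
theorem valueAtUniformizer_eq_inv_mul_inv_pow (lam ε : HeckeCharacter K) (m : ℕ) (v : HeightOneSpectrum (𝓞 K)) :
    ε.valueAtUniformizer v = ((ε * lam ^ m)⁻¹.valueAtUniformizer v)⁻¹ * (lam.valueAtUniformizer v ^ m)⁻¹ := by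
  have hpow : ∀ n : ℕ, (lam ^ n).valueAtUniformizer v = lam.valueAtUniformizer v ^ n := fun n ↦ by
    induction n with
    | zero => simp [HeckeCharacter.valueAtUniformizer, HeckeCharacter.localComponent_apply]
    | succ n ih => rw [pow_succ, HeckeCharacter.valueAtUniformizer_mul', ih, pow_succ]
  rw [HeckeCharacter.valueAtUniformizer_inv', inv_inv, HeckeCharacter.valueAtUniformizer_mul', hpow,
    mul_assoc, mul_inv_cancel₀ (pow_ne_zero _ (valueAtUniformizer_ne_zero₇ lam v)), mul_one]

/-! ## §3 The range decomposition -/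

/-- ★★ **RANGE DECOMPOSITION (complex-side input of the `j = 0` endpoint).**  Let `T` be a finite set of finite places, `λ` a Hecke
character of type `(1, 0)` and `ε` one of type `(−m, 0)`, both unramified outside `T`.  Then there is `M₀` such that for EVERY
`M ≥ M₀`, with `𝔪_M := ∏_{w∈T} w^{M+1}` (`modulusIdeal T (fun _ ↦ M)`) and `χ := ((ε·λ^m)⁻¹)(ϖ_·)`:
`(T, M)` is a module of definition of `λ` and of `ε`; `χ` is a ray class character modulo `𝔪_M`; at every `v ∤ 𝔪_M`,
`ε(ϖ_v) = χ(v)⁻¹ · λ(ϖ_v)^{−m}`; and `ε` is ramified only inside `T`.  These are the hypotheses `hlmod`, `hχ`, `hval`, `hram` of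
`DeShalit1987.sum_eisensteinE_eq_removedEulerFactorsAtZero_mul_continuation` (with `Tl := T`, `el := fun _ ↦ M`, `k := m`,
`η := ε`) — de Shalit's `ε = χ φ^k` read backwards, uniformly in the level `M` of the moduli `𝔣 𝔭̄^{M}` at which the `p`-adic side is
computed. [cite: deShalit1987, II.4.11 (29), II.4.12 (32), II.4.14 (36) (p. 65–71)] [cite: NeukirchANT1999, Ch. VII §6 Prop. (6.9), (6.11)–(6.14)] -/
theorem exists_rayClassCharacter_range_decomposition {T : Finset (HeightOneSpectrum (𝓞 K))}
    {lam ε : HeckeCharacter K} {m : ℕ}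
    (hl : lam.HasInfinityType (fun _ ↦ 1) (fun _ ↦ 0))
    (hlu : ∀ v : HeightOneSpectrum (𝓞 K), v ∉ T → lam.IsUnramifiedAt v)
    (hε : ε.HasInfinityType (fun _ ↦ -(m : ℤ)) (fun _ ↦ 0))
    (hεu : ∀ v : HeightOneSpectrum (𝓞 K), v ∉ T → ε.IsUnramifiedAt v) :
    ∃ M₀ : ℕ, ∀ M : ℕ, M₀ ≤ M →
      lam.IsModulus T (fun _ ↦ M) ∧ ε.IsModulus T (fun _ ↦ M) ∧ (ε * lam ^ m)⁻¹.IsModulus T (fun _ ↦ M) ∧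
      IsRayClassCharacter (HeckeCharacter.modulusIdeal T (fun _ ↦ M))
        (fun v ↦ (ε * lam ^ m)⁻¹.valueAtUniformizer v) ∧
      (∀ v : HeightOneSpectrum (𝓞 K), ¬ HeckeCharacter.modulusIdeal T (fun _ ↦ M) ≤ v.asIdeal →
        ε.valueAtUniformizer v =
          ((ε * lam ^ m)⁻¹.valueAtUniformizer v)⁻¹ * (lam.valueAtUniformizer v ^ m)⁻¹) ∧
      (∀ v : HeightOneSpectrum (𝓞 K), ¬ ε.IsUnramifiedAt v → v ∈ T) := by
  obtain ⟨Ml, hMl⟩ := exists_isModulus_const lam hlu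
  obtain ⟨Me, hMe⟩ := exists_isModulus_const ε hεu
  have htype := hasInfinityType_zero_mul_pow hl hε
  refine ⟨max Ml Me, fun M hM ↦ ?_⟩
  have hMl' := hMl M ((le_max_left _ _).trans hM)
  have hMe' := hMe M ((le_max_right _ _).trans hM)
  have hmod : (ε * lam ^ m)⁻¹.IsModulus T (fun _ ↦ M) :=
    isModulus_inv (KatzJZeroUnique.isModulus_mul hMe' (KatzJZeroUnique.isModulus_pow hMl' m))
  refine ⟨hMl', hMe', hmod,
    Summit.Langlands.Langlands.Theorems.ReciprocityUpToIrreducibility.isRayClassCharacter_of_isModulus_of_hasInfinityType_zero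
      htype hmod,
    fun v _ ↦ valueAtUniformizer_eq_inv_mul_inv_pow lam ε m v,
    fun v hv ↦ by by_contra hvT; exact hv (hεu v hvT)⟩

/-! ## §4 The exponent of a range character (the `hη`, `h1` inputs of the one-stop theorem) -/

/-- **A character of type `(−m, 0)` over a totally complex field has exponent `m/2`**: `‖ε(x)‖ = ‖x‖^{m/2}` for every idèle `x`
(`HeckeCharacter.norm_apply_eq_ideleNorm_rpow_of_hasInfinityType` with weight `−m`, every infinite place of multiplicity `2`, read at
a module of definition on the ramification set); so `L(ε, s)` converges absolutely at `s = 0` exactly when `m ≥ 3` (`1 < m/2`).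
[cite: WeilBNT1967, Ch. VII §7 (first paragraph)] [cite: deShalit1987, II.4.12 (32)–(33) (p. 66)] -/
theorem norm_apply_eq_ideleNorm_rpow_of_type_neg [IsTotallyComplex K] {T : Finset (HeightOneSpectrum (𝓞 K))}
    {ε : HeckeCharacter K} {m : ℕ} (hε : ε.HasInfinityType (fun _ ↦ -(m : ℤ)) (fun _ ↦ 0))
    (hεu : ∀ v : HeightOneSpectrum (𝓞 K), v ∉ T → ε.IsUnramifiedAt v) (x : ideleGroup K) :
    ‖((ε x : ℂˣ) : ℂ)‖ = ideleNorm x ^ ((m : ℝ) / 2) := by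
  obtain ⟨M₀, hM₀⟩ := exists_isModulus_const ε hεu
  haveI : Infinite (HeightOneSpectrum (𝓞 K)) := HeckeCharacter.infinite_heightOneSpectrum'' K
  obtain ⟨v₀, hv₀⟩ := Infinite.exists_notMem_finset T
  have hw : ∀ v : InfinitePlace K, 2 * ((fun _ ↦ -(m : ℤ)) v + (fun _ ↦ (0 : ℤ)) v) = (-(m : ℤ)) * v.mult := by
    intro v
    have hc : ¬ v.IsReal := InfinitePlace.not_isReal_iff_isComplex.mpr (IsTotallyComplex.isComplex v)
    simp [InfinitePlace.mult, hc]
    ring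
  have h := HeckeCharacter.norm_apply_eq_ideleNorm_rpow_of_hasInfinityType hε (hM₀ M₀ le_rfl) hw hv₀ x
  rw [h]
  congr 1
  push_cast
  ring

/-- `1 < m/2 ↔ 3 ≤ m` — the convergence threshold at `s = 0`. [cite: deShalit1987, II.4.12 (33) (p. 66)] -/
theorem one_lt_half_iff {m : ℕ} : (1 : ℝ) < (m : ℝ) / 2 ↔ 3 ≤ m := by
  rw [lt_div_iff₀ (by norm_num : (0:ℝ) < 2)]
  constructor
  · intro h
    have : (2 : ℝ) < m := by linarith
    exact_mod_cast (show (2 : ℕ) < m by exact_mod_cast this)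
  · intro h
    have : (3 : ℝ) ≤ m := by exact_mod_cast h
    linarith

end Summit.BirchSwinnertonDyer.BirchSwinnertonDyer.Theorems.PrintCf2.KatzJZeroRange


namespace Summit.BirchSwinnertonDyer.BirchSwinnertonDyer.Theorems.PrintCf2.KatzJZeroRange

open scoped Nat nonZeroDivisors
open Literature.NumberTheory.EllipticCurves.DeShalit1987 Literature.NumberTheory.GaloisRepresentations.HeckeCharacter

variable {K : Type} [Field K] [NumberField K]

/-! ## §5 The `j = 0` interpolation value IS `(1 − ε(𝔭)⁻¹p⁻¹) ×` the complex class sum (de Shalit II.4.14 (36) ⇐ (40)) -/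

/-- **Unfolding the interpolation value at `j = 0`**: for `ε` unramified at `v` and `m > 0`,
`interpolationValue p v v̄ S ε m 0 Ω δ L = (1 − ε(ϖ_v)⁻¹ p⁻¹) · ((m−1)! · Ω^{−m} · ∏_{w ∈ S ∪ {v̄}} (1 − ε(w)) · L)`
(`(2π/δ)^0 = 1`: `δ` is idle; `Γ(m) = (m−1)!`). [cite: deShalit1987, II.4.14 (36) (p. 71), II.4.11 (29) (p. 65)] -/
theorem interpolationValue_zero_eq (p : ℕ) {v vbar : HeightOneSpectrum (𝓞 K)} (S : Finset (HeightOneSpectrum (𝓞 K)))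
    {ε : HeckeCharacter K} (hεv : ε.IsUnramifiedAt v) {m : ℕ} (hm : 0 < m) (Ω δ Lval : ℂ) :
    interpolationValue p v vbar S ε m 0 Ω δ Lval =
      (1 - (ε.valueAtUniformizer v)⁻¹ * ((p : ℂ))⁻¹) *
        ((((m - 1)! : ℕ) : ℂ) * (Ω ^ m)⁻¹ * (removedEulerFactorsAtZero ε (insert vbar S) * Lval)) := by
  rw [interpolationValue, heckeValueExtZero_of_isUnramifiedAt hεv, gammaFactorAtZero_eq_factorial hm, add_zero, pow_zero]
  ring

/-- ★★ **THE `j = 0` INTERPOLATION VALUE IS THE EULER FACTOR AT `v` TIMES THE CLASS SUM OF EISENSTEIN NUMBERS** (de Shalit II.4.14: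
(36) from (40), `j = 0`).  `K` imaginary quadratic; `λ` of type `(1,0)` with module of definition `(S ∪ {v̄}, M)`, `𝔪 := ∏_{w∈S∪{v̄}} w^{M+1} ≠ (1)`,
`w_𝔪 = 1`; `χ` a ray class character mod `𝔪`, representatives `T`, class lattices `Λ_{L 𝔠} = Ω·σ(𝔪/𝔠)`; `ε` of type `(−m, 0)`,
`m ≥ 3`, unramified outside `S ∪ {v̄}` with `ε(ϖ_w) = χ(w)⁻¹λ(ϖ_w)^{−m}` off `𝔪` (the range decomposition of §3), `v ∉ S`, `v ≠ v̄`,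
entire `L(ε, s)`.  Then
`interpolationValue p v v̄ S ε m 0 Ω δ L(ε,0) = (1 − ε(ϖ_v)⁻¹ p⁻¹) · Σ_{𝔠∈T} χ̃(𝔠)⁻¹·λ̃(𝔠)^{−m}·E_m(Ω, L 𝔠)`.
[cite: deShalit1987, II.4.14 (36)–(40) (p. 71–73), II.3.5 (13)] -/
theorem interpolationValue_zero_eq_eulerFactor_mul_sum_eisensteinE [IsTotallyComplex K] (h2 : Module.finrank ℚ K = 2)
    (w₀ : InfinitePlace K) (p : ℕ) {v vbar : HeightOneSpectrum (𝓞 K)} {S : Finset (HeightOneSpectrum (𝓞 K))}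
    (hvS : v ∉ S) (hne : v ≠ vbar)
    {lam : HeckeCharacter K} {M : ℕ} (hl : lam.HasInfinityType (fun _ ↦ 1) (fun _ ↦ 0))
    (hlmod : lam.IsModulus (insert vbar S) (fun _ ↦ M))
    (h𝔪1 : HeckeCharacter.modulusIdeal (insert vbar S) (fun _ ↦ M) ≠ ⊤)
    (hw : ∀ u : (𝓞 K)ˣ, (u : 𝓞 K) - 1 ∈ HeckeCharacter.modulusIdeal (insert vbar S) (fun _ ↦ M) → u = 1)
    {χ : HeightOneSpectrum (𝓞 K) → ℂ} (hχ : IsRayClassCharacter (HeckeCharacter.modulusIdeal (insert vbar S) (fun _ ↦ M)) χ)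
    {T : Finset (Ideal (𝓞 K))} (hT : IsRayClassReps (HeckeCharacter.modulusIdeal (insert vbar S) (fun _ ↦ M)) T)
    {Ω : ℂ} (hΩ : Ω ≠ 0) (δ : ℂ) (L : Ideal (𝓞 K) → PeriodPair)
    (hL : ∀ 𝔠 ∈ T, ∀ z : ℂ, z ∈ (L 𝔠).lattice ↔
      ∃ x ∈ ((HeckeCharacter.modulusIdeal (insert vbar S) (fun _ ↦ M) : FractionalIdeal (𝓞 K)⁰ K) /
        (𝔠 : FractionalIdeal (𝓞 K)⁰ K)), z = Ω * w₀.embedding x)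
    {ε : HeckeCharacter K} {m : ℕ} (hε : ε.HasInfinityType (fun _ ↦ -(m : ℤ)) (fun _ ↦ 0))
    (hεu : ∀ w : HeightOneSpectrum (𝓞 K), w ∉ insert vbar S → ε.IsUnramifiedAt w)
    (hval : ∀ w : HeightOneSpectrum (𝓞 K), ¬ HeckeCharacter.modulusIdeal (insert vbar S) (fun _ ↦ M) ≤ w.asIdeal →
      ε.valueAtUniformizer w = (χ w)⁻¹ * (lam.valueAtUniformizer w ^ m)⁻¹)
    (hLε : LFunction.HasEntireContinuation (heckeLFunction ε)) (hm : 3 ≤ m) :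
    interpolationValue p v vbar S ε m 0 Ω δ (hLε.continuation 0) =
      (1 - (ε.valueAtUniformizer v)⁻¹ * ((p : ℂ))⁻¹) *
        ∑ 𝔠 ∈ T, (idealPow K χ 𝔠)⁻¹ * (idealPow K (fun w ↦ lam.valueAtUniformizer w) 𝔠 ^ m)⁻¹ * (L 𝔠).eisensteinE m Ω := by
  have hvT : v ∉ insert vbar S := by
    rw [Finset.mem_insert, not_or]; exact ⟨hne, hvS⟩
  rw [interpolationValue_zero_eq p S (hεu v hvT) (by omega) Ω δ,
    sum_eisensteinE_eq_removedEulerFactorsAtZero_mul_continuation h2 w₀ hl hlmod h𝔪1 hw hχ hT hΩ L hL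
      (norm_apply_eq_ideleNorm_rpow_of_type_neg hε hεu) (one_lt_half_iff.mpr hm) hval
      (fun w hw' ↦ by by_contra hwT; exact hw' (hεu w hwT)) hLε hm]

/-- ★★ **The 𝔞-TWISTED form** (what the elliptic-unit measure delivers before dividing by `12(N𝔞 − ε(𝔞))`, de Shalit II.4.14 (38)–(40)):
with `𝔞 ≠ 0` prime to `𝔪` and the twisted lattices `Λ_{L(𝔞𝔠)} = Ω·σ(𝔪/𝔞𝔠)`,
`(N𝔞 − χ̃(𝔞)λ̃(𝔞)^m) · interpolationValue p v v̄ S ε m 0 Ω δ L(ε,0)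
   = (1 − ε(ϖ_v)⁻¹ p⁻¹) · Σ_{𝔠∈T} χ̃(𝔠)⁻¹·λ̃(𝔠)^{−m}·(N𝔞·E_m(Ω, L 𝔠) − E_m(Ω, L(𝔞𝔠)))`.
[cite: deShalit1987, II.4.14 (36) and (38)–(40) (p. 71–73), II.4.11 (29)] -/
theorem twist_mul_interpolationValue_zero_eq_eulerFactor_mul_sum [IsTotallyComplex K] (h2 : Module.finrank ℚ K = 2)
    (w₀ : InfinitePlace K) (p : ℕ) {v vbar : HeightOneSpectrum (𝓞 K)} {S : Finset (HeightOneSpectrum (𝓞 K))}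
    (hvS : v ∉ S) (hne : v ≠ vbar)
    {lam : HeckeCharacter K} {M : ℕ} (hl : lam.HasInfinityType (fun _ ↦ 1) (fun _ ↦ 0))
    (hlmod : lam.IsModulus (insert vbar S) (fun _ ↦ M))
    (h𝔪1 : HeckeCharacter.modulusIdeal (insert vbar S) (fun _ ↦ M) ≠ ⊤)
    (hw : ∀ u : (𝓞 K)ˣ, (u : 𝓞 K) - 1 ∈ HeckeCharacter.modulusIdeal (insert vbar S) (fun _ ↦ M) → u = 1)
    {χ : HeightOneSpectrum (𝓞 K) → ℂ} (hχ : IsRayClassCharacter (HeckeCharacter.modulusIdeal (insert vbar S) (fun _ ↦ M)) χ)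
    {T : Finset (Ideal (𝓞 K))} (hT : IsRayClassReps (HeckeCharacter.modulusIdeal (insert vbar S) (fun _ ↦ M)) T)
    {𝔞 : Ideal (𝓞 K)} (h𝔞 : 𝔞 ≠ ⊥) (h𝔞cop : IsCoprime 𝔞 (HeckeCharacter.modulusIdeal (insert vbar S) (fun _ ↦ M)))
    {Ω : ℂ} (hΩ : Ω ≠ 0) (δ : ℂ) (L : Ideal (𝓞 K) → PeriodPair)
    (hL : ∀ 𝔠 ∈ T, ∀ z : ℂ, z ∈ (L 𝔠).lattice ↔
      ∃ x ∈ ((HeckeCharacter.modulusIdeal (insert vbar S) (fun _ ↦ M) : FractionalIdeal (𝓞 K)⁰ K) /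
        (𝔠 : FractionalIdeal (𝓞 K)⁰ K)), z = Ω * w₀.embedding x)
    (hL𝔞 : ∀ 𝔠 ∈ T, ∀ z : ℂ, z ∈ (L (𝔞 * 𝔠)).lattice ↔
      ∃ x ∈ ((HeckeCharacter.modulusIdeal (insert vbar S) (fun _ ↦ M) : FractionalIdeal (𝓞 K)⁰ K) /
        ((𝔞 * 𝔠 : Ideal (𝓞 K)) : FractionalIdeal (𝓞 K)⁰ K)), z = Ω * w₀.embedding x)
    {ε : HeckeCharacter K} {m : ℕ} (hε : ε.HasInfinityType (fun _ ↦ -(m : ℤ)) (fun _ ↦ 0))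
    (hεu : ∀ w : HeightOneSpectrum (𝓞 K), w ∉ insert vbar S → ε.IsUnramifiedAt w)
    (hval : ∀ w : HeightOneSpectrum (𝓞 K), ¬ HeckeCharacter.modulusIdeal (insert vbar S) (fun _ ↦ M) ≤ w.asIdeal →
      ε.valueAtUniformizer w = (χ w)⁻¹ * (lam.valueAtUniformizer w ^ m)⁻¹)
    (hLε : LFunction.HasEntireContinuation (heckeLFunction ε)) (hm : 3 ≤ m) :
    ((Ideal.absNorm 𝔞 : ℂ) - idealPow K χ 𝔞 * idealPow K (fun w ↦ lam.valueAtUniformizer w) 𝔞 ^ m) *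
        interpolationValue p v vbar S ε m 0 Ω δ (hLε.continuation 0) =
      (1 - (ε.valueAtUniformizer v)⁻¹ * ((p : ℂ))⁻¹) *
        ∑ 𝔠 ∈ T, (idealPow K χ 𝔠)⁻¹ * (idealPow K (fun w ↦ lam.valueAtUniformizer w) 𝔠 ^ m)⁻¹ *
          ((Ideal.absNorm 𝔞 : ℂ) * (L 𝔠).eisensteinE m Ω - (L (𝔞 * 𝔠)).eisensteinE m Ω) := by
  have hvT : v ∉ insert vbar S := by
    rw [Finset.mem_insert, not_or]; exact ⟨hne, hvS⟩
  rw [interpolationValue_zero_eq p S (hεu v hvT) (by omega) Ω δ,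
    sum_twist_eisensteinE_eq_removedEulerFactorsAtZero_mul_continuation h2 w₀ hl hlmod h𝔪1 hw hχ hT h𝔞 h𝔞cop hΩ L hL hL𝔞
      (norm_apply_eq_ideleNorm_rpow_of_type_neg hε hεu) (one_lt_half_iff.mpr hm) hval
      (fun w hw' ↦ by by_contra hwT; exact hw' (hεu w hwT)) hLε hm]
  ring

end Summit.BirchSwinnertonDyer.BirchSwinnertonDyer.Theorems.PrintCf2.KatzJZeroRange

end
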